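import Literature.Geometry.Lorentzian.CoordSlice
import Literature.Geometry.Lorentzian.CauchyDevelopment
import HarnessLib

/-!
# The data embedding of a coordinate slice, and its independence of the metric beyond first
# order along the slice

Continuation of `CoordSlice.lean`. For a connected chart domain `T : Opens E4` carrying a
time-oriented Lorentzian metric `(g, τ)` with representative `G`, a connected chart domain
`B : Opens E3` with `{0} × B ⊆ T` along which the slices `{x⁰ = const}` are spacelike
(`lapseSq G dt > 0`) and the slice normal is future-directed, and an initial data set `D` on `B`
agreeing with the induced pair `(ι^* g, K_ν)`:

* `CoordSlice.sliceDataEmbedding` — **the slice as a data embedding of `D`**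
  (`DataEmbedding`, `CauchyDevelopment.lean`; Ringström 2009, Def. 16.2; Sbierski 2016, Def. 2.2
  without the Cauchy clause): spacetime `(T, g, τ)`, embedding `ι : y ↦ (0, y)`, future unit normal
  `ν = -♯dt/√lapseSq`; vacuum iff `Ric(g) = 0` (`sliceDataEmbedding_isVacuum`).
* **First-order agreement.** If a second metric `g'` on `T` with representative `G'` satisfies
  `G' = G` and `DG' = DG` at the points of the slice, then it induces the SAME data there:
  the slice normals agree (`sliceNormalField_congr`), the induced metrics agree
  (`pullbackBilin_sliceEmbed_congr`) and the second fundamental forms agree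
  (`secondFundamentalForm_sliceEmbed_congr`: in coordinates
  `K_ν(v, w) = G(DN v, w̃) + ½ (∂G)(N, ṽ, w̃)` involves `G` and its first derivatives only,
  `OpensChart.secondFundamentalForm_eq_of_repr`, `OpensChart.val_christoffel_const`; O'Neill 1983,
  Ch. 3, Prop. 3.13 and Ch. 4, Lemma 4.4; Wald 1984, (10.2.13)). Hence an initial data set for
  `g` is one for `g'` (`initialDataSet_congr`). The hypothesis is met when `G' = G` on an open set
  whose closure contains the slice, both being `C¹` (`eq_and_fderiv_eq_of_eqOn`): the situation of
  two isometric spacetimes read in one chart across the boundary of the region where the isometry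
  is defined (Sbierski 2016, §3.2, proof of Thm. 12: "suitable neighbourhoods of `S` in `M` and of
  `ψ(S)` in `M'` are GHDs of `(S, ḡ_S, k_S)`").

Everything is proved; the only definition is the data embedding; no named facts (D-0026).

## References

* J. Sbierski, Ann. Henri Poincaré 17 (2016) 301–329 = arXiv:1309.7591v3, Def. 2.2 and §3.2,
  proof of Thm. 12 (arXiv numbering). [Sbierski2016AHP]
* H. Ringström, *The Cauchy Problem in General Relativity*, EMS 2009, Def. 16.2. [Ringstrom2009]
* B. O'Neill, *Semi-Riemannian geometry with applications to relativity*, Academic Press 1983,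
  Ch. 3, Prop. 3.13; Ch. 4, Lemma 4.4. [ONeillSemiRiemannian1983]
* R. M. Wald, *General Relativity*, Chicago 1984, §10.2, (10.2.10)–(10.2.13). [Wald1984]
-/

noncomputable section

open Bundle Set Function Filter TopologicalSpace Manifold Module
open scoped Manifold ContDiff Topology

namespace Literature.Geometry.Lorentzian

namespace CoordSlice

universe u

/-! ### Agreement to first order on the closure of an open set -/

section Closure

variable {E F : Type*} [NormedAddCommGroup E] [NormedSpace ℝ E] [NormedAddCommGroup F]
  [NormedSpace ℝ F]

/-- **Two `C¹` maps agreeing on an open set agree to first order on its closure** (within the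
open domain of differentiability): if `G₁ = G₂` on an open `O ⊆ T`, `T` open, and both are `C¹`
on `T`, then `G₁ x = G₂ x` and `DG₁(x) = DG₂(x)` for every `x ∈ T ∩ closure O` (continuity of the
maps and of their derivatives on `T`). [folklore] -/
theorem eq_and_fderiv_eq_of_eqOn {G₁ G₂ : E → F} {T O : Set E} (hT : IsOpen T) (hO : IsOpen O)
    (hOT : O ⊆ T) (h : EqOn G₁ G₂ O) (h₁ : ContDiffOn ℝ 1 G₁ T) (h₂ : ContDiffOn ℝ 1 G₂ T)
    {x : E} (hx : x ∈ T) (hxO : x ∈ closure O) :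
    G₁ x = G₂ x ∧ fderiv ℝ G₁ x = fderiv ℝ G₂ x := by
  have hsub : O ⊆ T ∩ closure O := fun y hy ↦ ⟨hOT hy, subset_closure hy⟩
  have hcl : T ∩ closure O ⊆ closure O := inter_subset_right
  refine ⟨?_, ?_⟩
  · exact h.of_subset_closure (h₁.continuousOn.mono inter_subset_left)
      (h₂.continuousOn.mono inter_subset_left) hsub hcl ⟨hx, hxO⟩
  · have hd : EqOn (fderiv ℝ G₁) (fderiv ℝ G₂) O := fun y hy ↦
      Filter.EventuallyEq.fderiv_eq (Filter.eventuallyEq_of_mem (hO.mem_nhds hy) h)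
    exact hd.of_subset_closure ((h₁.continuousOn_fderiv_of_isOpen hT le_rfl).mono inter_subset_left)
      ((h₂.continuousOn_fderiv_of_isOpen hT le_rfl).mono inter_subset_left) hsub hcl ⟨hx, hxO⟩

end Closure

/-! ### Coordinate objects depend on the metric only through its low-order jet -/

section Congr

variable {E : Type*} [NormedAddCommGroup E] [NormedSpace ℝ E]
  {G₁ G₂ : E → E →L[ℝ] E →L[ℝ] ℝ} {ℓ : E →L[ℝ] ℝ} {x : E}

/-- `♯` at `x` depends only on `G x`. [folklore] -/
theorem sharpAt_congr (h0 : G₁ x = G₂ x) : MetricCoord.sharpAt G₁ x = MetricCoord.sharpAt G₂ x := by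
  unfold MetricCoord.sharpAt
  rw [h0]

/-- `lapseSq` at `x` depends only on `G x`. [folklore] -/
theorem lapseSq_congr (h0 : G₁ x = G₂ x) :
    MetricCoord.lapseSq G₁ ℓ x = MetricCoord.lapseSq G₂ ℓ x := by
  rw [MetricCoord.lapseSq_def, MetricCoord.lapseSq_def, sharpAt_congr h0]

/-- The slice normal at `x` depends only on `G x`. [folklore] -/
theorem sliceNormal_congr (h0 : G₁ x = G₂ x) :
    MetricCoord.sliceNormal G₁ ℓ x = MetricCoord.sliceNormal G₂ ℓ x := by
  rw [MetricCoord.sliceNormal_def, MetricCoord.sliceNormal_def, sharpAt_congr h0, lapseSq_congr h0]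

/-- The Koszul form at `x` depends only on `DG(x)`. [folklore] -/
theorem koszulForm_congr (h1 : fderiv ℝ G₁ x = fderiv ℝ G₂ x) (Y X Z : E) :
    OpensChart.koszulForm G₁ x Y X Z = OpensChart.koszulForm G₂ x Y X Z := by
  rw [OpensChart.koszulForm_apply, OpensChart.koszulForm_apply, h1]

end Congr

/-! ### First-order agreement of two metrics along the slice gives the same induced data -/

section TwoMetrics

variable {T : Opens E4} {B : Opens E3} {hBT : ∀ y ∈ B, E4.ofTimeSpace 0 y ∈ T}
  {g₁ g₂ : LorentzianMetric 𝓘(ℝ, E4) ∞ T} {G₁ G₂ : E4 → E4 →L[ℝ] E4 →L[ℝ] ℝ}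
  (hG₁ : ∀ x : T, g₁.val x = G₁ x) (hG₂ : ∀ x : T, g₂.val x = G₂ x)
  (h0 : ∀ y : B, G₁ (E4.ofTimeSpace 0 y) = G₂ (E4.ofTimeSpace 0 y))

include h0 in
/-- Metrics agreeing along the slice have the same slice normal field. [folklore] -/
theorem sliceNormalField_congr : sliceNormalField hBT G₁ = sliceNormalField hBT G₂ := by
  funext y
  have h := sliceNormal_congr (ℓ := dt) (h0 y)
  exact h

include h0 in
/-- Metrics agreeing along the slice have the same positivity of `lapseSq` there. [folklore] -/
theorem lapseSq_pos_congr (hlapse : ∀ y : B, 0 < MetricCoord.lapseSq G₁ dt (E4.ofTimeSpace 0 y))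
    (y : B) : 0 < MetricCoord.lapseSq G₂ dt (E4.ofTimeSpace 0 y) := by
  rw [← lapseSq_congr (h0 y)]
  exact hlapse y

include hG₁ hG₂ h0 in
/-- **Metrics agreeing along the slice induce the same metric on it**: `ι^* g₁ = ι^* g₂`.
[cite: Wald1984, §10.2, (10.2.12)] -/
theorem pullbackBilin_sliceEmbed_congr (y : B) :
    pullbackBilin (I := 𝓘(ℝ, E4)) (I' := 𝓘(ℝ, E3)) (sliceEmbed hBT) g₁.val y =
      pullbackBilin (I := 𝓘(ℝ, E4)) (I' := 𝓘(ℝ, E3)) (sliceEmbed hBT) g₂.val y := by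
  ext v w
  rw [pullbackBilin_apply, pullbackBilin_apply, mfderiv_sliceEmbed_apply, mfderiv_sliceEmbed_apply,
    val_apply_eq hG₁, val_apply_eq hG₂, coe_sliceEmbed, h0 y]

include hG₁ hG₂ h0 in
/-- **Metrics agreeing to first order along the slice induce the same second fundamental form on
it.** In coordinates `K_ν(v, w) = g(DN v + Γ(N)(ṽ), w̃)` with `g(Γ(N)(ṽ), w̃) = ½ K(N, ṽ, w̃)`
(`OpensChart.secondFundamentalForm_eq_of_repr`, `OpensChart.val_christoffel_const`; O'Neill 1983,
Ch. 3, Prop. 3.13, Ch. 4, Lemma 4.4; Wald 1984, (10.2.13)): the value of `G` at the slice point,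
its first derivatives there (the Koszul form), the normal `N` (a function of `G` along the slice)
and its derivative along the slice are all the same for the two metrics. [cite: ONeillSemiRiemannian1983, Ch. 4, Lemma 4.4] -/
theorem secondFundamentalForm_sliceEmbed_congr [g₁.toPseudoRiemannianMetric.HasLeviCivita]
    [g₂.toPseudoRiemannianMetric.HasLeviCivita]
    (h1 : ∀ y : B, fderiv ℝ G₁ (E4.ofTimeSpace 0 y) = fderiv ℝ G₂ (E4.ofTimeSpace 0 y))
    (hlapse : ∀ y : B, 0 < MetricCoord.lapseSq G₁ dt (E4.ofTimeSpace 0 y)) (y : B) (v w : E3) :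
    g₁.toPseudoRiemannianMetric.secondFundamentalForm 𝓘(ℝ, E3) (sliceEmbed hBT)
        (sliceNormalField hBT G₁) y v w =
      g₂.toPseudoRiemannianMetric.secondFundamentalForm 𝓘(ℝ, E3) (sliceEmbed hBT)
        (sliceNormalField hBT G₂) y v w := by
  have hmet₁ : MetricCoord.IsMetricOn G₁ (T : Set E4) :=
    OpensChart.isMetricOn_repr (g := g₁.toPseudoRiemannianMetric) hG₁
  have hmet₂ : MetricCoord.IsMetricOn G₂ (T : Set E4) :=
    OpensChart.isMetricOn_repr (g := g₂.toPseudoRiemannianMetric) hG₂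
  set N₁ : E3 → E4 := fun z ↦ MetricCoord.sliceNormal G₁ dt (E4.ofTimeSpace 0 z) with hN₁
  set N₂ : E3 → E4 := fun z ↦ MetricCoord.sliceNormal G₂ dt (E4.ofTimeSpace 0 z) with hN₂
  have hN₁d : DifferentiableAt ℝ N₁ y :=
    ((hmet₁.contDiffAt_sliceNormal (hBT y y.2) (hlapse y)).differentiableAt (by simp)).comp
      (y : E3) (hasFDerivAt_ofTimeSpace_zero _).differentiableAt
  have hN₂d : DifferentiableAt ℝ N₂ y :=
    ((hmet₂.contDiffAt_sliceNormal (hBT y y.2) (lapseSq_pos_congr h0 hlapse y)).differentiableAt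
      (by simp)).comp (y : E3) (hasFDerivAt_ofTimeSpace_zero _).differentiableAt
  -- the two normal representatives agree on the open set `B`, hence have the same derivative
  have hNeq : ∀ z : B, N₁ z = N₂ z := fun z ↦ sliceNormal_congr (h0 z)
  have hNev : N₁ =ᶠ[𝓝 (y : E3)] N₂ :=
    Filter.eventuallyEq_of_mem (B.isOpen.mem_nhds y.2) fun z hz ↦ hNeq ⟨z, hz⟩
  have hDN : fderiv ℝ N₁ y = fderiv ℝ N₂ y := hNev.fderiv_eq
  -- the Christoffel terms are half Koszul forms of the components
  set X : E4 := fderiv ℝ (E4.ofTimeSpace 0) y v with hX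
  set W : E4 := fderiv ℝ (E4.ofTimeSpace 0) y w with hW
  have hΓ₁ : G₁ (sliceEmbed hBT y)
      (OpensChart.christoffel g₁.toPseudoRiemannianMetric G₁ (sliceEmbed hBT y) (N₁ y) X) W =
      2⁻¹ * OpensChart.koszulForm G₁ (sliceEmbed hBT y) (N₁ y) X W := by
    rw [← val_apply_eq hG₁]
    exact OpensChart.val_christoffel_const (g := g₁.toPseudoRiemannianMetric) (G := G₁)
      (sliceEmbed hBT y) (N₁ y) X W
  have hΓ₂ : G₂ (sliceEmbed hBT y)
      (OpensChart.christoffel g₂.toPseudoRiemannianMetric G₂ (sliceEmbed hBT y) (N₂ y) X) W =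
      2⁻¹ * OpensChart.koszulForm G₂ (sliceEmbed hBT y) (N₂ y) X W := by
    rw [← val_apply_eq hG₂]
    exact OpensChart.val_christoffel_const (g := g₂.toPseudoRiemannianMetric) (G := G₂)
      (sliceEmbed hBT y) (N₂ y) X W
  rw [OpensChart.secondFundamentalForm_eq_of_repr (g := g₁.toPseudoRiemannianMetric) (G := G₁)
      hG₁ (f := sliceEmbed hBT) (Φ := E4.ofTimeSpace 0) (fun _ ↦ rfl)
      (ν := sliceNormalField hBT G₁) (N := N₁) (fun _ ↦ rfl)
      (hasFDerivAt_ofTimeSpace_zero _).differentiableAt hN₁d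
      (OpensChart.differentiableAt_repr hG₁ _) v w,
    OpensChart.secondFundamentalForm_eq_of_repr (g := g₂.toPseudoRiemannianMetric) (G := G₂)
      hG₂ (f := sliceEmbed hBT) (Φ := E4.ofTimeSpace 0) (fun _ ↦ rfl)
      (ν := sliceNormalField hBT G₂) (N := N₂) (fun _ ↦ rfl)
      (hasFDerivAt_ofTimeSpace_zero _).differentiableAt hN₂d
      (OpensChart.differentiableAt_repr hG₂ _) v w,
    val_apply_eq hG₁, val_apply_eq hG₂]
  change G₁ (sliceEmbed hBT y) (fderiv ℝ N₁ y v +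
      OpensChart.christoffel g₁.toPseudoRiemannianMetric G₁ (sliceEmbed hBT y) (N₁ y) X) W =
    G₂ (sliceEmbed hBT y) (fderiv ℝ N₂ y v +
      OpensChart.christoffel g₂.toPseudoRiemannianMetric G₂ (sliceEmbed hBT y) (N₂ y) X) W
  rw [map_add, map_add, add_apply, add_apply, hΓ₁, hΓ₂, hDN,
    hNeq y, coe_sliceEmbed, koszulForm_congr (h1 y), h0 y]

include hG₁ hG₂ h0 in
/-- **An initial data set induced by `g₁` on the slice is induced by `g₂`** when the two metrics
agree to first order along the slice. [cite: ONeillSemiRiemannian1983, Ch. 4, Lemma 4.4] -/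
theorem initialDataSet_congr [g₁.toPseudoRiemannianMetric.HasLeviCivita]
    (h1 : ∀ y : B, fderiv ℝ G₁ (E4.ofTimeSpace 0 y) = fderiv ℝ G₂ (E4.ofTimeSpace 0 y))
    (hlapse : ∀ y : B, 0 < MetricCoord.lapseSq G₁ dt (E4.ofTimeSpace 0 y))
    {D : InitialDataSet 𝓘(ℝ, E3) B}
    (hDh : ∀ y : B, D.h.inner y =
      pullbackBilin (I := 𝓘(ℝ, E4)) (I' := 𝓘(ℝ, E3)) (sliceEmbed hBT) g₁.val y)
    (hDk : ∀ y : B, (D.k y).toLinearMap₁₂ =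
      g₁.toPseudoRiemannianMetric.secondFundamentalForm 𝓘(ℝ, E3) (sliceEmbed hBT)
        (sliceNormalField hBT G₁) y) :
    (∀ y : B, D.h.inner y =
        pullbackBilin (I := 𝓘(ℝ, E4)) (I' := 𝓘(ℝ, E3)) (sliceEmbed hBT) g₂.val y) ∧
      ∀ [g₂.toPseudoRiemannianMetric.HasLeviCivita] (y : B), (D.k y).toLinearMap₁₂ =
        g₂.toPseudoRiemannianMetric.secondFundamentalForm 𝓘(ℝ, E3) (sliceEmbed hBT)
          (sliceNormalField hBT G₂) y := by
  refine ⟨fun y ↦ ?_, fun y ↦ ?_⟩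
  · rw [hDh y, pullbackBilin_sliceEmbed_congr hG₁ hG₂ h0 y]
  · rw [hDk y]
    exact LinearMap.ext₂ fun v w ↦
      secondFundamentalForm_sliceEmbed_congr hG₁ hG₂ h0 h1 hlapse y v w

end TwoMetrics

/-! ### The slice as a data embedding -/

section DataEmbedding

variable {T : Opens E4} (hT : IsConnected (T : Set E4)) (g : LorentzianMetric 𝓘(ℝ, E4) ∞ T)
  (τ : TimeOrientation g) {G : E4 → E4 →L[ℝ] E4 →L[ℝ] ℝ} (hG : ∀ x : T, g.val x = G x)
  {B : Opens E3} [ConnectedSpace B] (hBT : ∀ y ∈ B, E4.ofTimeSpace 0 y ∈ T)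
  (D : InitialDataSet 𝓘(ℝ, E3) B)
  (hDh : ∀ y : B, D.h.inner y =
    pullbackBilin (I := 𝓘(ℝ, E4)) (I' := 𝓘(ℝ, E3)) (sliceEmbed hBT) g.val y)
  (hDk : ∀ [g.toPseudoRiemannianMetric.HasLeviCivita] (y : B), (D.k y).toLinearMap₁₂ =
    g.toPseudoRiemannianMetric.secondFundamentalForm 𝓘(ℝ, E3) (sliceEmbed hBT)
      (sliceNormalField hBT G) y)
  (hlapse : ∀ y : B, 0 < MetricCoord.lapseSq G dt (E4.ofTimeSpace 0 y))
  (hfut : ∀ y : B, τ.IsFutureDirected (x := sliceEmbed hBT y) (sliceNormalField hBT G y))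

/-- **The coordinate slice as a data embedding.** The time-oriented Lorentzian chart domain
`(T, g, τ)` (connected), the slice embedding `ι : B → T`, `y ↦ (0, y)` (a smooth embedding,
`isSmoothEmbedding_sliceEmbed`) of the connected chart domain `B`, and the future unit normal
`ν = -♯dt/√lapseSq` (`isFutureUnitNormal_sliceNormalField`) form a data embedding of every initial
data set `D = (h, k)` on `B` with `h = ι^* g` and `k = K_ν` (`DataEmbedding`: Ringström 2009,
Def. 16.2; Sbierski 2016, Def. 2.2, without the Cauchy-hypersurface clause). [cite: Sbierski2016AHP, §2, Def. 2.2] -/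
def sliceDataEmbedding : DataEmbedding D where
  toSpacetime :=
    { carrier := T
      metric := g
      timeOrientation := τ
      connectedSpace := isConnected_iff_connectedSpace.mp hT }
  embed := sliceEmbed hBT
  isSmoothEmbedding := isSmoothEmbedding_sliceEmbed
  normal := sliceNormalField hBT G
  isFutureUnitNormal := isFutureUnitNormal_sliceNormalField hG τ hlapse hfut
  induced_h := fun y ↦ (hDh y).symm
  induced_k := by
    intro inst y
    refine LinearMap.ext₂ fun v w ↦ ?_
    have h := congrArg (fun K : LinearMap.BilinForm ℝ (TangentSpace 𝓘(ℝ, E3) y) ↦ K v w) (hDk y)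
    simp only [ContinuousLinearMap.toLinearMap₁₂_apply] at h
    rw [InitialDataSet.kBilin_apply, ← h]

/-- The spacetime of the slice data embedding is `(T, g, τ)`. [folklore] -/
theorem sliceDataEmbedding_carrier :
    (sliceDataEmbedding hT g τ hG hBT D hDh hDk hlapse hfut).carrier = T := rfl

/-- The metric of the slice data embedding is `g`. [folklore] -/
theorem sliceDataEmbedding_metric :
    (sliceDataEmbedding hT g τ hG hBT D hDh hDk hlapse hfut).metric = g := rfl

/-- The time orientation of the slice data embedding is `τ`. [folklore] -/
theorem sliceDataEmbedding_timeOrientation :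
    (sliceDataEmbedding hT g τ hG hBT D hDh hDk hlapse hfut).timeOrientation = τ := rfl

/-- The embedding of the slice data embedding is `ι : y ↦ (0, y)`. [folklore] -/
theorem sliceDataEmbedding_embed :
    (sliceDataEmbedding hT g τ hG hBT D hDh hDk hlapse hfut).embed = sliceEmbed hBT := rfl

/-- The normal of the slice data embedding is the slice normal field. [folklore] -/
theorem sliceDataEmbedding_normal :
    (sliceDataEmbedding hT g τ hG hBT D hDh hDk hlapse hfut).normal = sliceNormalField hBT G := rfl

/-- **The slice data embedding is vacuum iff the chart metric is Ricci-flat** (for every proof of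
the standing Levi-Civita hypothesis). Ringström 2009, Def. 16.3. [cite: Ringstrom2009, Def. 16.3] -/
theorem sliceDataEmbedding_isVacuum
    (hRic : ∀ [g.toPseudoRiemannianMetric.HasLeviCivita], g.toPseudoRiemannianMetric.IsRicciFlat) :
    (sliceDataEmbedding hT g τ hG hBT D hDh hDk hlapse hfut).IsVacuum := by
  intro inst
  haveI : g.toPseudoRiemannianMetric.HasLeviCivita := inst
  exact hRic

/-- The normal of the slice data embedding is differentiable along the embedding as a map into
`TT` (the displayed hypothesis `hν` of `DataEmbedding.restrict`). [folklore] -/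
theorem mdifferentiableAt_normal_sliceDataEmbedding (y : B) :
    MDifferentiableAt (𝓡 3) (𝓡 4).tangent
      (fun y ↦ (TotalSpace.mk' E4
        ((sliceDataEmbedding hT g τ hG hBT D hDh hDk hlapse hfut).embed y)
        ((sliceDataEmbedding hT g τ hG hBT D hDh hDk hlapse hfut).normal y) :
          TangentBundle (𝓡 4) T)) y :=
  mdifferentiableAt_lift_sliceNormalField (hBT := hBT)
    (contMDiff_lift_sliceNormalField (hBT := hBT) hG hlapse) y

end DataEmbedding

end CoordSlice

end Literature.Geometry.Lorentzian

end
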